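import Literature.AlgebraicGeometry.Resolution.GenericFormSimpleZeros
import Literature.AlgebraicGeometry.Resolution.SmoothFibreChart
import Literature.AlgebraicGeometry.Resolution.FormsOnAffineCharts
import HarnessLib

/-!
# A generic form cuts the smooth fibre curve transversally: the chart hypotheses of `GenericFormSimpleZeros`

Topic: `Literature/AlgebraicGeometry/Resolution`. Pure proofs (no definition, no named fact) of
the chart computation feeding the second genericity statement of de Jong's proof of his
multisection lemma (de Jong 1996, Lemma 4.13, p. 70: "by Bertini the general hyperplane `H` will
intersect `(f⁻¹(y) ∩ sm(X/Y))_red` transversally") into the abstract form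
`isGeneric_forall_locallyGenerates_sum_smul` (`GenericFormSimpleZeros.lean`), for a closed
subscheme `r : X ↪ ℙⁿ_k` (`k` algebraically closed), a morphism `f : X → Y` whose fibres are
curves, a closed point `y` and a basic open chart `W = (r⁻¹D₊(xᵢ))_h ⊆ f⁻¹(U)` all of whose
closed points over `y` are smooth points of `f`:

* `exists_locallyGenerates_sub_algebraMap` — the algebra: if a `k`-algebra `D` is generated by
  elements `t_j` up to a unit `u` (`d u^N ∈ k[t]` for every `d`) and `D_𝔪` is a discrete
  valuation ring at a `k`-rational maximal ideal `𝔪`, then some `t_j - t_j(𝔪)` is a uniformiser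
  (`LocallyGenerates`): otherwise `𝔪 D_𝔪 ⊆ 𝔪² D_𝔪`;
* `finiteType_sec` (private) — sections over an affine open of a `k`-scheme locally of finite
  type form a finitely generated `k`-algebra (Mathlib `HasRingHomProperty.appLE`);
* `exists_chartMonomial_sub_locallyGenerates` — on `W`, modulo any ideal `N` (here `𝔫A`, the
  fibre over `y`), at a maximal ideal with discrete valuation ring some chart value
  `c_μ = (x_j/x_i)` of a monomial of degree `m ≥ 1`, shifted by a constant, is a uniformiser
  (Hartshorne II Prop. 7.2: `Γ(W)` is generated by the ratios and `1/h`);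
* **`isGeneric_forall_locallyGenerates_fibreRing`** — for generic coefficients `a`, the chart
  value `G_a(s)/s_i^m|_W` of the form `G_a = Σ a_μ x^μ` generates, in the fibre ring
  `A/𝔫A` (`A = Γ(W)`), every maximal ideal containing it: the input of
  `isReduced_fiber_subschemeι_comp_of_locallyGenerates` (`SubschemeFibreReduced.lean`) for the
  reducedness of `H ∩ f⁻¹(y)`, `H = X ∩ V₊(G_a)`.

## References

* A. J. de Jong, *Smoothness, semi-stability and alterations*, Publ. Math. IHÉS 83 (1996),
  Lemma 4.13 (proof), p. 70. [DeJong1996]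
* R. Hartshorne, *Algebraic Geometry*, GTM 52 (1977), II Prop. 7.2, II Thm. 8.18.
  [Hartshorne1977]
-/

noncomputable section

universe u v w

open CategoryTheory AlgebraicGeometry Limits TopologicalSpace Opposite IsLocalRing
open MvPolynomial (X C aeval)
open Literature.AlgebraicGeometry.Motives Literature.AlgebraicGeometry.Motives.Segre
  Literature.AlgebraicGeometry.Motives.GeneratingSections

attribute [local instance] MvPolynomial.gradedAlgebra

namespace Literature.AlgebraicGeometry.Resolution

/-! ### Algebra: a uniformiser among the generators -/

section Algebra

variable {k : Type u} [Field k] {D : Type v} [CommRing D] [Algebra k D] {κ : Type w}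

/-- **Taylor expansion to first order**: `P(t) - P(x) ∈ (t_j - x_j)_j` for a polynomial `P` over
`k`, elements `t_j` of a `k`-algebra and constants `x_j ∈ k`. [folklore] -/
private theorem aeval_sub_algebraMap_eval_mem_span (t : κ → D) (x : κ → k) (P : MvPolynomial κ k) :
    aeval t P - algebraMap k D (MvPolynomial.eval x P) ∈
      Ideal.span (Set.range fun j => t j - algebraMap k D (x j)) := by
  induction P using MvPolynomial.induction_on with
  | C a => simp
  | add p q hp hq =>
    have : aeval t (p + q) - algebraMap k D (MvPolynomial.eval x (p + q)) =
        (aeval t p - algebraMap k D (MvPolynomial.eval x p)) +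
          (aeval t q - algebraMap k D (MvPolynomial.eval x q)) := by
      simp only [map_add]; ring
    rw [this]
    exact Ideal.add_mem _ hp hq
  | mul_X p j hp =>
    have : aeval t (p * X j) - algebraMap k D (MvPolynomial.eval x (p * X j)) =
        (aeval t p - algebraMap k D (MvPolynomial.eval x p)) * t j +
          algebraMap k D (MvPolynomial.eval x p) * (t j - algebraMap k D (x j)) := by
      simp only [map_mul, MvPolynomial.aeval_X, MvPolynomial.eval_X, map_mul]; ring
    rw [this]
    exact Ideal.add_mem _ (Ideal.mul_mem_right _ _ hp)
      (Ideal.mul_mem_left _ _ (Ideal.subset_span ⟨j, rfl⟩))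

/-- **Some `t_j - t_j(𝔪)` is a uniformiser.** Let `D` be a `k`-algebra with elements `t_j` and a
unit `u` such that every `d ∈ D` satisfies `d u^N = P(t)` for some polynomial `P` over `k`
(e.g. `D` a quotient of `k[t][1/h]`, `u` the class of `h`), and `𝔪` a maximal ideal with residue
field `k` (`d ≡ const mod 𝔪`) at which `D_𝔪` is a discrete valuation ring. Then for some `j`
and the constant `x_j` with `t_j - x_j ∈ 𝔪`, the element `t_j - x_j` generates `𝔪` locally:
otherwise every `t_j - x_j` lies in `(𝔪 D_𝔪)²` (`locallyGenerates_or_mem_sq`), hence so does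
every `P(t)` with `P(x) = 0`, hence `𝔪 D_𝔪 ⊆ (𝔪 D_𝔪)²` and `𝔪 D_𝔪 = 0` by Nakayama — but a
discrete valuation ring is not a field. This is the algebra behind "`H` is defined by
`(h) ⊂ 𝒪_{X,x}` with `h̄ ∉ 𝔪²_{x,f⁻¹(y)}`" for the generic hyperplane through a smooth point of
the fibre curve (de Jong 1996, proof of 4.13, p. 70): among the affine coordinates one is a local
parameter. [cite: DeJong1996, Lemma 4.13 (proof), p. 70] -/
theorem exists_locallyGenerates_sub_algebraMap (t : κ → D) {u : D} (hu : IsUnit u)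
    (hgen : ∀ d : D, ∃ (N : ℕ) (P : MvPolynomial κ k), d * u ^ N = aeval t P)
    (𝔪 : Ideal D) [𝔪.IsMaximal] [IsDomain (Localization.AtPrime 𝔪)]
    [IsDiscreteValuationRing (Localization.AtPrime 𝔪)]
    (hres : ∀ d : D, ∃ x : k, d - algebraMap k D x ∈ 𝔪) :
    ∃ (j : κ) (x : k), t j - algebraMap k D x ∈ 𝔪 ∧ LocallyGenerates 𝔪 (t j - algebraMap k D x) := by
  choose x hx using fun j => hres (t j)
  by_contra hcon
  push Not at hcon
  set O := Localization.AtPrime 𝔪 with hO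
  -- every `t_j - x_j` lies in `(𝔪 O)²`
  have hsq : ∀ j, algebraMap D O (t j - algebraMap k D (x j)) ∈ (maximalIdeal O) ^ 2 := fun j =>
    (locallyGenerates_or_mem_sq 𝔪 (hx j)).resolve_left (hcon j (x j) (hx j))
  have hspan : (Ideal.span (Set.range fun j => t j - algebraMap k D (x j))).map (algebraMap D O) ≤
      (maximalIdeal O) ^ 2 := by
    rw [Ideal.map_span, Ideal.span_le]
    rintro _ ⟨_, ⟨j, rfl⟩, rfl⟩
    exact hsq j
  -- hence every element of `𝔪` does
  have hmem : ∀ d ∈ 𝔪, algebraMap D O d ∈ (maximalIdeal O) ^ 2 := by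
    intro d hd
    obtain ⟨N, P, hP⟩ := hgen d
    have hTaylor := aeval_sub_algebraMap_eval_mem_span t x P
    -- `P(x) = 0`: `P(t) ∈ 𝔪` and `P(t) - P(x) ∈ 𝔪`
    have hPt : aeval t P ∈ 𝔪 := hP ▸ Ideal.mul_mem_right _ _ hd
    have hgen𝔪 : Ideal.span (Set.range fun j => t j - algebraMap k D (x j)) ≤ 𝔪 := by
      rw [Ideal.span_le]
      rintro _ ⟨j, rfl⟩
      exact hx j
    have hPx : MvPolynomial.eval x P = 0 := by
      by_contra hne
      have hcm : algebraMap k D (MvPolynomial.eval x P) ∈ 𝔪 := by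
        have := Ideal.sub_mem _ hPt (hgen𝔪 hTaylor)
        rwa [sub_sub_cancel] at this
      exact Ideal.IsPrime.ne_top inferInstance
        (Ideal.eq_top_of_isUnit_mem _ hcm ((IsUnit.mk0 _ hne).map _))
    rw [hPx, map_zero, sub_zero] at hTaylor
    have h1 : algebraMap D O (aeval t P) ∈ (maximalIdeal O) ^ 2 :=
      hspan (Ideal.mem_map_of_mem _ hTaylor)
    rw [← hP, map_mul, map_pow] at h1
    exact (Ideal.unit_mul_mem_iff_mem _ ((hu.map _).pow N)).mp (by rwa [mul_comm] at h1)
  -- so `𝔪 O ⊆ (𝔪 O)²`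
  have hle : maximalIdeal O ≤ (maximalIdeal O) ^ 2 := by
    intro z hz
    obtain ⟨⟨d, s⟩, hzs⟩ := IsLocalization.surj 𝔪.primeCompl z
    simp only at hzs
    have hsu : IsUnit (algebraMap D O s) := IsLocalization.map_units O s
    have hdO : algebraMap D O d ∈ maximalIdeal O := by
      rw [← hzs]; exact Ideal.mul_mem_right _ _ hz
    have hd : d ∈ 𝔪 := (IsLocalization.AtPrime.to_map_mem_maximal_iff O 𝔪 d).mp hdO
    have h2 := hmem d hd
    rw [← hzs] at h2
    exact (Ideal.unit_mul_mem_iff_mem _ hsu).mp (by rwa [mul_comm] at h2)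
  -- Nakayama: `𝔪 O = 0`, contradicting that `O` is a discrete valuation ring
  have hbot : maximalIdeal O = ⊥ := by
    refine Submodule.eq_bot_of_le_smul_of_le_jacobson_bot (maximalIdeal O) (maximalIdeal O)
      (IsNoetherian.noetherian _) ?_ ?_
    · rw [Ideal.smul_eq_mul, ← sq]; exact hle
    · exact IsLocalRing.maximalIdeal_le_jacobson ⊥
  exact IsDiscreteValuationRing.not_a_field' (R := O) hbot

end Algebra

/-! ### Sections over an affine open are of finite type -/

section FiniteType

variable {k : Type u} [Field k] {Z : SchemeOver k}

attribute [local instance] FieldNorm.secAlgebra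

/-- **`Γ(X, V)` is a finitely generated `k`-algebra** for an affine open `V` of a `k`-scheme `X`
locally of finite type (Mathlib `HasRingHomProperty.appLE` for `@LocallyOfFiniteType`).
[folklore] -/
private theorem finiteType_sec [LocallyOfFiniteType Z.hom] {V : Z.left.Opens} (hV : IsAffineOpen V) :
    Algebra.FiniteType k Γ(Z.left, V) := by
  have h1 : (Z.hom.appLE ⊤ V le_top).hom.FiniteType :=
    HasRingHomProperty.appLE @LocallyOfFiniteType Z.hom inferInstance
      ⟨⊤, isAffineOpen_top _⟩ ⟨V, hV⟩ le_top
  have h2 : (Scheme.ΓSpecIso (.of k)).inv.hom.FiniteType :=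
    RingHom.FiniteType.of_surjective _
      (Scheme.ΓSpecIso (.of k)).commRingCatIsoToRingEquiv.symm.surjective
  have h3 := RingHom.FiniteType.comp h1 h2
  rw [← CommRingCat.hom_comp] at h3
  exact h3

/-- The same for a quotient of `Γ(X, V)`. [folklore] -/
private theorem finiteType_sec_quotient [LocallyOfFiniteType Z.hom] {V : Z.left.Opens} (hV : IsAffineOpen V)
    (N : Ideal Γ(Z.left, V)) : Algebra.FiniteType k (Γ(Z.left, V) ⧸ N) :=
  haveI := finiteType_sec (Z := Z) hV
  Algebra.FiniteType.of_surjective (Ideal.Quotient.mkₐ k N) Ideal.Quotient.mk_surjective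

end FiniteType

/-! ### The chart: ratios as generators, a uniformiser among the chart values -/

section Chart

variable {k : Type u} [Field k] {Z : SchemeOver k} {n : ℕ} (ι : Z ⟶ projectiveSpace n k)
  (i : Fin (n + 1)) (h : Γ(Z.left, preU (emb ι) i))

attribute [local instance] FieldNorm.secAlgebra

/-- The restriction `Γ(X, r⁻¹D₊(xᵢ)) → Γ(X, W) → Γ(X, W)/N` to a basic open `W = (r⁻¹D₊(xᵢ))_h`
followed by a quotient, as a `k`-algebra map. [folklore] -/
private def resQuot (N : Ideal Γ(Z.left, Z.left.basicOpen h)) :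
    Γ(Z.left, preU (emb ι) i) →ₐ[k] Γ(Z.left, Z.left.basicOpen h) ⧸ N :=
  { toRingHom := (Ideal.Quotient.mk N).comp
      (Z.left.presheaf.map (homOfLE (Z.left.basicOpen_le h)).op).hom
    commutes' := fun c => by
      change Ideal.Quotient.mk N ((Z.left.presheaf.map (homOfLE (Z.left.basicOpen_le h)).op).hom
        (algebraMap k Γ(Z.left, preU (emb ι) i) c)) = algebraMap k _ c
      rw [FieldNorm.map_algebraMap_sec (Z.left.basicOpen_le h) c]
      rfl }

/-- Unfolding `resQuot`. [folklore] -/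
private theorem resQuot_apply (N : Ideal Γ(Z.left, Z.left.basicOpen h))
    (b : Γ(Z.left, preU (emb ι) i)) :
    resQuot ι i h N b =
      Ideal.Quotient.mk N (Z.left.presheaf.map (homOfLE (Z.left.basicOpen_le h)).op b) := rfl

/-- **A uniformiser among the chart values of the monomials.** Let `r : X ↪ ℙⁿ_k` be a closed
immersion over an algebraically closed field `k`, `X` locally of finite type, `W = (r⁻¹D₊(xᵢ))_h` a
basic open of the `i`-th chart, `N ⊆ A = Γ(X, W)` an ideal, `m ≥ 1`, and `𝔪` a maximal ideal of
`A/N` at which `(A/N)_𝔪` is a discrete valuation ring. Then for some monomial `x^μ` of degree `m`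
and some constant `x ∈ k`, the class of the chart value `c_μ - x` lies in `𝔪` and generates it
locally: `A` is generated over `k` by the ratios `x_j/x_i` and `1/h` (Hartshorne II Prop. 7.2),
so some `x_j/x_i - const` is a uniformiser (`exists_locallyGenerates_sub_algebraMap`), and
`x_j/x_i = c_{(m-1)e_i + e_j}`. [cite: Hartshorne1977, II Prop. 7.2] -/
theorem exists_chartMonomial_sub_locallyGenerates [IsClosedImmersion ι.left] [IsAlgClosed k]
    [LocallyOfFiniteType Z.hom] {m : ℕ} (hm : 1 ≤ m) (N : Ideal Γ(Z.left, Z.left.basicOpen h))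
    (𝔪 : Ideal (Γ(Z.left, Z.left.basicOpen h) ⧸ N)) [𝔪.IsMaximal]
    [IsDomain (Localization.AtPrime 𝔪)] [IsDiscreteValuationRing (Localization.AtPrime 𝔪)] :
    ∃ (μ : Monomials (Fin (n + 1)) m) (x : k),
      Ideal.Quotient.mk N (Z.left.presheaf.map (homOfLE (Z.left.basicOpen_le h)).op
          (chartMonomial ι i m μ)) - algebraMap k _ x ∈ 𝔪 ∧
        LocallyGenerates 𝔪 (Ideal.Quotient.mk N (Z.left.presheaf.map
          (homOfLE (Z.left.basicOpen_le h)).op (chartMonomial ι i m μ)) - algebraMap k _ x) := by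
  haveI : IsClosedImmersion (emb ι) := ‹_›
  have hWaff : IsAffineOpen (Z.left.basicOpen h) := (isAffineOpen_ofHom_U (emb ι) i).basicOpen h
  haveI : Algebra.FiniteType k (Γ(Z.left, Z.left.basicOpen h) ⧸ N) :=
    finiteType_sec_quotient (Z := Z) hWaff N
  set θ := resQuot ι i h N with hθ
  -- generators: the ratios `t_j`, the unit `u = h|_W`
  set t : Fin (n + 1) → Γ(Z.left, Z.left.basicOpen h) ⧸ N := fun j => θ (homRatio (emb ι) i j)
    with ht
  haveI hloc : IsLocalization.Away h Γ(Z.left, Z.left.basicOpen h) :=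
    (isAffineOpen_ofHom_U (emb ι) i).isLocalization_basicOpen h
  have hu : IsUnit (θ h) := by
    rw [hθ, resQuot_apply]
    exact (IsLocalization.Away.algebraMap_isUnit (S := Γ(Z.left, Z.left.basicOpen h)) h).map _
  have hgen : ∀ d : Γ(Z.left, Z.left.basicOpen h) ⧸ N, ∃ (M : ℕ) (P : MvPolynomial (Fin (n + 1)) k),
      d * θ h ^ M = aeval t P := by
    intro d
    obtain ⟨a, rfl⟩ := Ideal.Quotient.mk_surjective d
    obtain ⟨⟨b, ⟨_, M, rfl⟩⟩, hab⟩ := IsLocalization.surj (Submonoid.powers h) a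
    obtain ⟨P, hP⟩ := exists_eq_aeval_homRatio ι i b
    refine ⟨M, P, ?_⟩
    have h1 : θ b = aeval t P := by
      rw [hP, ← AlgHom.comp_apply, MvPolynomial.comp_aeval]
    have h2 : Ideal.Quotient.mk N a * θ h ^ M = θ b := by
      rw [hθ, resQuot_apply, resQuot_apply, ← map_pow, ← map_mul, ← map_pow]
      congr 1
    rw [h2, h1]
  have hres : ∀ d : Γ(Z.left, Z.left.basicOpen h) ⧸ N, ∃ x : k, d - algebraMap k _ x ∈ 𝔪 :=
    fun d => Literature.RingTheory.KrullDimension.exists_sub_algebraMap_mem_of_isMaximal k 𝔪 d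
  obtain ⟨j, x, hjx, hgenj⟩ := exists_locallyGenerates_sub_algebraMap t hu hgen 𝔪 hres
  -- `j ≠ i`: `t_i = 1`, and `1 - x` is not a uniformiser
  have hji : j ≠ i := by
    rintro rfl
    have hti : t j = 1 := by
      simp only [ht, homRatio_self, map_one]
    rw [hti] at hjx hgenj
    have h0 : (1 : Γ(Z.left, Z.left.basicOpen h) ⧸ N) - algebraMap k _ x = 0 := by
      by_contra hne
      have : (1 : Γ(Z.left, Z.left.basicOpen h) ⧸ N) - algebraMap k _ x = algebraMap k _ (1 - x) := by
        rw [map_sub, map_one]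
      rw [this] at hjx hne
      have hx1 : (1 : k) - x ≠ 0 := fun h' => hne (by rw [h', map_zero])
      exact Ideal.IsPrime.ne_top inferInstance
        (Ideal.eq_top_of_isUnit_mem _ hjx ((IsUnit.mk0 _ hx1).map _))
    have hnsq := hgenj.not_mem_sq hjx
    rw [h0, map_zero] at hnsq
    exact hnsq (zero_mem _)
  refine ⟨monoPow i j m ⟨1, by omega⟩, x, ?_, ?_⟩
  · have : Ideal.Quotient.mk N (Z.left.presheaf.map (homOfLE (Z.left.basicOpen_le h)).op
        (chartMonomial ι i m (monoPow i j m ⟨1, by omega⟩))) = t j := by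
      rw [chartMonomial_monoPow ι hji, pow_one]; rfl
    rw [this]; exact hjx
  · have : Ideal.Quotient.mk N (Z.left.presheaf.map (homOfLE (Z.left.basicOpen_le h)).op
        (chartMonomial ι i m (monoPow i j m ⟨1, by omega⟩))) = t j := by
      rw [chartMonomial_monoPow ι hji, pow_one]; rfl
    rw [this]; exact hgenj

end Chart

/-! ### The generic form generates the maximal ideals of the fibre ring at its zeros -/

section Main

variable {k : Type u} [Field k] [IsAlgClosed k] {Z : SchemeOver k} {n : ℕ}
  (ι : Z ⟶ projectiveSpace n k) [IsClosedImmersion ι.left] [LocallyOfFiniteType Z.hom]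
  {Y : Scheme.{u}} (f : Z.left ⟶ Y) [LocallyOfFinitePresentation f] [JacobsonSpace Z.left]

attribute [local instance] FieldNorm.secAlgebra

/-- **For a generic form `G`, the chart value of `G` locally generates every maximal ideal of
the fibre ring containing it.** Let `r : X ↪ ℙⁿ_k` (`k` algebraically closed, `X` locally of
finite type over `k`), `f : X → Y` locally of finite presentation with all irreducible
components of all fibres of dimension `1`, `y` a closed point of an affine open `U ⊆ Y` with
prime `𝔫`, `W = (r⁻¹D₊(xᵢ))_h ⊆ f⁻¹(U)` a basic open chart all of whose closed points over `y`
are smooth points of `f`, and `m ≥ 1`. Then for generic coefficient vectors `a` (`IsGeneric`),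
the class in the fibre ring `D = Γ(X, W)/𝔫Γ(X, W)` of the chart value `G_a(s)/s_i^m` of the form
`G_a = Σ a_μ x^μ` generates locally every maximal ideal of `D` containing it — i.e. `G_a` has
only simple zeros on the smooth curve `f⁻¹(y) ∩ W`: "by Bertini the general hyperplane `H` will
intersect `(f⁻¹(y) ∩ sm(X/Y))_red` transversally". Assembled from
`isGeneric_forall_locallyGenerates_sum_smul` with the discrete-valuation-ring property of the
local rings of `D` (`isDiscreteValuationRing_localization_atMaximal_fibreRing`), `c_{m eᵢ} = 1`
and `exists_chartMonomial_sub_locallyGenerates`. [cite: DeJong1996, Lemma 4.13 (proof), p. 70] -/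
theorem isGeneric_forall_locallyGenerates_fibreRing
    (hdim : ∀ (y : Y), ∀ C ∈ irreducibleComponents ↥(f.fiber y), topologicalKrullDim ↥C = 1)
    {U : Y.Opens} (hU : IsAffineOpen U) (i : Fin (n + 1)) (h : Γ(Z.left, preU (emb ι) i))
    (hW : IsAffineOpen (Z.left.basicOpen h)) (hWU : Z.left.basicOpen h ≤ f ⁻¹ᵁ U) {y : Y}
    (hyU : y ∈ U) (hy : IsClosed ({y} : Set Y)) {m : ℕ} (hm : 1 ≤ m)
    (hsm : ∀ p : PrimeSpectrum Γ(Z.left, Z.left.basicOpen h), p.asIdeal.IsMaximal →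
      fibreIdeal f hU hWU hyU ≤ p.asIdeal → hW.fromSpec p ∈ f.smoothLocus) :
    IsGeneric fun a : Monomials (Fin (n + 1)) m → k =>
      ∀ 𝔪 : Ideal (Γ(Z.left, Z.left.basicOpen h) ⧸ fibreIdeal f hU hWU hyU), 𝔪.IsMaximal →
        Ideal.Quotient.mk _ (Z.left.presheaf.map (homOfLE (Z.left.basicOpen_le h)).op
            ((ofHom (emb ι)).sectionsFun Z.hom i (formOfCoeffs a))) ∈ 𝔪 →
          LocallyGenerates 𝔪 (Ideal.Quotient.mk _ (Z.left.presheaf.map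
            (homOfLE (Z.left.basicOpen_le h)).op
              ((ofHom (emb ι)).sectionsFun Z.hom i (formOfCoeffs a)))) := by
  classical
  haveI : IsClosedImmersion (emb ι) := ‹_›
  set N := fibreIdeal f hU hWU hyU with hN
  haveI : Algebra.FiniteType k (Γ(Z.left, Z.left.basicOpen h) ⧸ N) :=
    finiteType_sec_quotient (Z := Z) hW N
  set θ := resQuot ι i h N with hθ
  -- the chart values `c_μ` of the monomials, in `D`
  set c : Monomials (Fin (n + 1)) m → Γ(Z.left, Z.left.basicOpen h) ⧸ N :=
    fun μ => θ (chartMonomial ι i m μ) with hc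
  -- `G_a(s)/s_i^m = Σ a_μ c_μ`
  have hval : ∀ a : Monomials (Fin (n + 1)) m → k,
      Ideal.Quotient.mk N (Z.left.presheaf.map (homOfLE (Z.left.basicOpen_le h)).op
        ((ofHom (emb ι)).sectionsFun Z.hom i (formOfCoeffs a))) = ∑ μ, a μ • c μ := by
    intro a
    change θ ((ofHom (emb ι)).sectionsFun Z.hom i (formOfCoeffs a)) = _
    rw [sectionsFun_formOfCoeffs, map_sum]
    refine Finset.sum_congr rfl fun μ _ => ?_
    rw [map_smul]
  -- the hypotheses of `isGeneric_forall_locallyGenerates_sum_smul`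
  have hdvr : ∀ (𝔪 : Ideal (Γ(Z.left, Z.left.basicOpen h) ⧸ N)) [𝔪.IsMaximal],
      ∃ _ : IsDomain (Localization.AtPrime 𝔪), IsDiscreteValuationRing (Localization.AtPrime 𝔪) :=
    fun 𝔪 _ => isDiscreteValuationRing_localization_atMaximal_fibreRing f hU hW hWU hdim hyU hy
      hsm 𝔪
  have hD : ringKrullDim (Γ(Z.left, Z.left.basicOpen h) ⧸ N) ≤ 1 :=
    ringKrullDim_le_one_of_forall_isMaximal_dvr fun 𝔪 _ => hdvr 𝔪
  have h1 : ∃ μ₀, c μ₀ = 1 := ⟨monoSelf i m, by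
    simp only [hc, chartMonomial_monoSelf, map_one]⟩
  have hunif : ∀ (𝔪 : Ideal (Γ(Z.left, Z.left.basicOpen h) ⧸ N)) [𝔪.IsMaximal],
      ∃ (μ : Monomials (Fin (n + 1)) m) (x : k),
        c μ - algebraMap k _ x ∈ 𝔪 ∧ LocallyGenerates 𝔪 (c μ - algebraMap k _ x) := by
    intro 𝔪 _
    obtain ⟨hdom, hdvr'⟩ := hdvr 𝔪
    haveI := hdom
    haveI := hdvr'
    exact exists_chartMonomial_sub_locallyGenerates ι i h hm N 𝔪
  have key := isGeneric_forall_locallyGenerates_sum_smul k c hD hdvr h1 hunif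
  refine key.mono fun a ha 𝔪 h𝔪 hg => ?_
  rw [hval] at hg ⊢
  exact ha 𝔪 h𝔪 hg

end Main

end Literature.AlgebraicGeometry.Resolution

end
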